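import Literature.Probability.LatticeModels.StoppedWalkSums
import HarnessLib

/-!
# Lawler's formula for the loop-erased walk stopped at a set, and the symmetry of the Green's-function products

Topic `Probability/LatticeModels`; namespace `Literature.Probability.LatticeModels.StoppedWalk`.
Second layer of the tree's proof of Wilson's algorithm / Pemantle's theorem
(`WilsonAlgorithm.lean`), for a general one-step weight `q : V → V → ℝ≥0∞` and the sums of
`StoppedWalkSums.lean`:

* `le q S a L` — **the loop-erased measure of the walk stopped at `S`**: the `q`-mass of the
  walks `a :: t` stopped on first hitting `S` whose chronological loop erasure is `a :: L`
  (Lawler 2018, §3 Def. 2: `q̂(η) = ∑_{ω : LE(ω) = η} q(ω)`; Kozdron–Richards–Stroock (2013), §5: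
  `𝒫^Δ(y₁,…,y_K)`, "the probability that `(y₁,…,y_K)` will be the successive points visited by
  the loop erasure of the segment `{Xₙ : 0 ≤ n ≤ ξ^Δ}` of the Markov chain started at `y₁`");
* `lam q S a L` — **Lawler's product** `∏_{k<K} G_{Δ_kᶜ}(y_k,y_k) q(y_k,y_{k+1})`,
  `Δ_k = S ∪ {y₁,…,y_{k-1}}`, and **Lawler's formula** `le_eq_lam` for a self-avoiding path
  stopped at `S` (Lawler 2018, Prop. 3.1; Kozdron–Richards–Stroock (2013), eq. (5.4) "(Lawler)":
  `𝒫^Δ(y₁,…,y_K) = ∏_{k=1}^{K-1} ((I-P)^{Δ_k})⁻¹_{y_k y_k} / d_{y_k}`), proved by the loop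
  decomposition at the last visit to the initial vertex (`le_cons`, the tree's
  `splitLastEquiv`);
* `tsum_le` — the fibres of loop erasure partition the stopped walks: `∑_L le S a L = hit' S a`;
* `greenProd q S [u₁,…,u_m] = ∏ᵢ G_{(S ∪ {u₁,…,u_{i-1}})ᶜ}(uᵢ,uᵢ)` and its **invariance under
  reordering** `greenProd_perm` — the heart of the Green's-function proof of Wilson's theorem
  (Kozdron–Richards–Stroock (2013), Thm. 2.1 and eq. (5.2): "the interest … is that it shows that
  the product on the left is independent of the permutation `σ`"; there via Cramer's rule and
  determinants, HERE by the elementary two-point symmetry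
  `G_{Sᶜ}(x,x) G_{(S∪x)ᶜ}(y,y) = G_{Sᶜ}(y,y) G_{(S∪y)ᶜ}(x,x)` (`loopAt_mul_loopAt_insert_comm`),
  itself from the last-visit decompositions `loopAt_eq_loopAt_insert_add` and
  `reach_eq_loopAt_mul_reach` — Lawler 2018, §2–§3 path surgery — and adjacent transpositions).

## References

* G. F. Lawler, *Topics in loop measures and the loop-erased walk*, Probab. Surveys 15 (2018),
  §3 Def. 1–2, Prop. 3.1 (held: arXiv:1709.07531). [Lawler2018]
* M. J. Kozdron, L. M. Richards, D. W. Stroock, arXiv:1306.2059 (2013), Thm. 2.1, §5.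
  [KozdronRichardsStroock2013]
-/

noncomputable section

open scoped ENNReal Classical
open Literature.Probability.RandomPlanarGeometry
open Literature.Probability.LatticeModels.LoopErasedWalkIdentity

namespace Literature.Probability.LatticeModels

namespace StoppedWalk

variable {V : Type*} [DecidableEq V]

/-! ### The loop-erased measure of the stopped walk and Lawler's product -/

section Defs

variable (q : V → V → ℝ≥0∞)

/-- **The loop-erased measure of the walk stopped at `S`**: `le q S a L` is the `q`-mass of the
walks `a :: t` stopped on first hitting `S` (`IsStoppedAt S (a :: t)`) whose chronological loop
erasure is the path `a :: L` — the law of the loop-erased walk from `a` stopped at `S`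
evaluated at `a :: L` (Lawler 2018, §3 Def. 2, `q̂(η) = ∑_{ω : LE(ω)=η} q(ω)`; Kozdron–Richards–
Stroock (2013), §5, `𝒫^Δ(y₁,…,y_K)`). [cite: Lawler2018, §3 Definition 2] -/
def le (S : Set V) (a : V) (L : List V) : ℝ≥0∞ :=
  wsum q a (fun t => IsStoppedAt S (a :: t) ∧ loopErase (a :: t) = a :: L)

/-- **Lawler's product** for the path `a :: L` relative to `S`:
`lam S a [] = [a ∈ S]`, `lam S a (b :: L) = G_{Sᶜ}(a,a) · q(a,b) · lam (S ∪ {a}) b L`, i.e.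
`q(η) ∏_j G_{A_j}(η_j,η_j)` with `A_j = (S ∪ {η₀,…,η_{j-1}})ᶜ` over the non-final vertices
(Lawler 2018, Prop. 3.1; Kozdron–Richards–Stroock (2013), eq. (5.4)).
[cite: Lawler2018, Proposition 3.1] -/
def lam : Set V → V → List V → ℝ≥0∞
  | S, a, [] => if a ∈ S then 1 else 0
  | S, a, b :: L => loopAt q S a * q a b * lam (insert a S) b L

/-- **The product of Green's functions along an ordering**:
`greenProd S [u₁,…,u_m] = ∏ᵢ G_{(S ∪ {u₁,…,u_{i-1}})ᶜ}(uᵢ,uᵢ)` (Kozdron–Richards–Stroock (2013),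
Thm. 2.1 / eq. (5.1): `∏_m (ℒ^{{x₁,…,x_m}})⁻¹_{x_{m+1}x_{m+1}}`, up to the degree factors).
[cite: KozdronRichardsStroock2013, Theorem 2.1] -/
def greenProd : Set V → List V → ℝ≥0∞
  | _, [] => 1
  | S, u :: l => loopAt q S u * greenProd (insert u S) l

omit [DecidableEq V] in
/-- `lam` of a final vertex. [folklore] -/
@[simp] theorem lam_nil (S : Set V) (a : V) : lam q S a [] = if a ∈ S then 1 else 0 := rfl

omit [DecidableEq V] in
/-- `lam` of a path with a first step. [folklore] -/
@[simp] theorem lam_cons (S : Set V) (a b : V) (L : List V) :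
    lam q S a (b :: L) = loopAt q S a * q a b * lam q (insert a S) b L := rfl

omit [DecidableEq V] in
/-- `greenProd` of the empty ordering. [folklore] -/
@[simp] theorem greenProd_nil (S : Set V) : greenProd q S [] = 1 := rfl

omit [DecidableEq V] in
/-- `greenProd` of an ordering with a first vertex. [folklore] -/
@[simp] theorem greenProd_cons (S : Set V) (u : V) (l : List V) :
    greenProd q S (u :: l) = loopAt q S u * greenProd q (insert u S) l := rfl

end Defs

variable {q : V → V → ℝ≥0∞}

/-! ### Lawler's formula -/

/-- The loop-erased measure of a final vertex: the only walk stopped at `S` with loop erasure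
`[a]` is the trivial walk, present iff `a ∈ S`. [folklore] -/
theorem le_nil (S : Set V) (a : V) : le q S a [] = if a ∈ S then 1 else 0 := by
  rw [le]
  by_cases ha : a ∈ S
  · rw [if_pos ha]
    refine wsum_eq_one_of_iff_nil q fun t => ?_
    constructor
    · exact fun h => h.1.eq_singleton_of_head_mem ha
    · rintro rfl
      exact ⟨isStoppedAt_singleton ha, by simp⟩
  · rw [if_neg ha]
    refine wsum_eq_zero q fun t h => ?_
    obtain ⟨hst, hle⟩ := h
    have hlast := getLast?_loopErase (a :: t)
    rw [hle] at hlast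
    have h1 : (a :: t).getLast (List.cons_ne_nil a t) = a := by
      rw [List.getLast?_eq_some_getLast (List.cons_ne_nil a t)] at hlast
      simpa using hlast.symm
    have h2 := hst.getLast_mem
    rw [h1] at h2
    exact ha h2

omit [DecidableEq V] in
/-- Stopping at `S ∪ {a}` versus stopping at `S`, for walks missing `a`. [folklore] -/
theorem isStoppedAt_insert_iff {S : Set V} {a : V} {w : List V} (haw : a ∉ w) :
    IsStoppedAt (insert a S) w ↔ IsStoppedAt S w := by
  constructor
  · rintro ⟨hne, hlast, hdrop⟩
    refine ⟨hne, ?_, fun x hx h => hdrop x hx (Set.mem_insert_of_mem a h)⟩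
    rcases (Set.mem_insert_iff).1 hlast with h | h
    · exact absurd (h ▸ List.getLast_mem hne) haw
    · exact h
  · rintro ⟨hne, hlast, hdrop⟩
    refine ⟨hne, Set.mem_insert_of_mem a hlast, fun x hx h => ?_⟩
    rcases (Set.mem_insert_iff).1 h with rfl | h
    · exact haw (List.dropLast_subset w hx)
    · exact hdrop x hx h

/-- **The first loop of the decomposition** (Lawler 2018, proof of Prop. 3.1, for the walk
stopped at `S`): a walk `a :: t` stopped at `S` with `LE = a :: b :: L'` splits at its last
visit to `a` as (loop at `a` off `S`) ⊕ (step `a → b`) ⊕ (walk from `b` stopped at `S` missing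
`a`, with `LE = b :: L'`), bijectively and with multiplicative weights; hence
`le S a (b :: L') = G_{Sᶜ}(a,a) · q(a,b) · le (S ∪ {a}) b L'`.
[cite: Lawler2018, Proposition 3.1 (proof)] -/
theorem le_cons {S : Set V} {a b : V} {L' : List V} (ha : a ∉ S) (haL : a ∉ b :: L') :
    le q S a (b :: L') = loopAt q S a * q a b * le q (insert a S) b L' := by
  -- Step 1: rewrite the defining condition through `afterLast a t`.
  have step1 : le q S a (b :: L') =
      wsum q a (fun t => IsStoppedAt S t ∧ loopErase (afterLast a t) = b :: L') := by
    refine wsum_congr q fun t => ?_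
    rw [isStoppedAt_cons_iff, loopErase_cons, List.cons_eq_cons]
    simp [ha]
  rw [step1, wsum, tsum_eq_tsum_splitLast a]
  -- Step 2: on the image of the splitting the condition and the weight factor.
  have step2 : ∀ p : {c : List V // c = [] ∨ c.getLast? = some a} × {ρ : List V // a ∉ ρ},
      (if IsStoppedAt S (p.1.1 ++ p.2.1) ∧ loopErase (afterLast a (p.1.1 ++ p.2.1)) = b :: L'
        then pw q a (p.1.1 ++ p.2.1) else 0) =
      (if (p.1.1 = [] ∨ p.1.1.getLast? = some a) ∧ Avoids S p.1.1 then pw q a p.1.1 else 0) *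
        (if IsStoppedAt S p.2.1 ∧ loopErase p.2.1 = b :: L' then pw q a p.2.1 else 0) := by
    rintro ⟨⟨c, hc⟩, ⟨ρ, hρ⟩⟩
    simp only
    rw [afterLast_append_of hc hρ]
    by_cases h2 : IsStoppedAt S ρ ∧ loopErase ρ = b :: L'
    · have hρne : ρ ≠ [] := h2.1.1
      rw [if_pos h2]
      by_cases h1 : Avoids S c
      · rw [if_pos ⟨isStoppedAt_append_left h1 h2.1, h2.2⟩, if_pos ⟨hc, h1⟩,
          pw_append_of_loop q hc]
      · rw [if_neg (fun h => h1 (isStoppedAt_of_append h.1 hρne).1), if_neg (fun h => h1 h.2),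
          zero_mul]
    · rw [if_neg h2, mul_zero, if_neg]
      rintro ⟨hst, hle⟩
      have hρne : ρ ≠ [] := by
        rintro rfl
        simp at hle
      exact h2 ⟨(isStoppedAt_of_append hst hρne).2, hle⟩
  trans ∑' p : {c : List V // c = [] ∨ c.getLast? = some a} × {ρ : List V // a ∉ ρ},
      (if (p.1.1 = [] ∨ p.1.1.getLast? = some a) ∧ Avoids S p.1.1 then pw q a p.1.1 else 0) *
        (if IsStoppedAt S p.2.1 ∧ loopErase p.2.1 = b :: L' then pw q a p.2.1 else 0)
  · exact tsum_congr fun p => by convert step2 p using 3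
  rw [ENNReal.tsum_prod']
  simp_rw [ENNReal.tsum_mul_left]
  rw [ENNReal.tsum_mul_right]
  -- Step 3: identify the two factors.
  have fac1 : (∑' c : {c : List V // c = [] ∨ c.getLast? = some a},
      (if (c.1 = [] ∨ c.1.getLast? = some a) ∧ Avoids S c.1 then pw q a c.1 else 0)) =
      loopAt q S a := by
    rw [tsum_subtype_eq_tsum_ite (fun c : List V => c = [] ∨ c.getLast? = some a)
      (fun c : List V => if (c = [] ∨ c.getLast? = some a) ∧ Avoids S c then pw q a c else 0)]
    rw [loopAt, wsum]
    refine tsum_congr fun c => ?_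
    by_cases hc : c = [] ∨ c.getLast? = some a
    · rw [if_pos hc]
      exact ite_congr_prop _ _ Iff.rfl
    · rw [if_neg hc, if_neg (fun h => hc h.1)]
  have fac2 : (∑' ρ : {ρ : List V // a ∉ ρ},
      (if IsStoppedAt S ρ.1 ∧ loopErase ρ.1 = b :: L' then pw q a ρ.1 else 0)) =
      q a b * le q (insert a S) b L' := by
    rw [tsum_subtype_eq_tsum_ite (fun ρ : List V => a ∉ ρ)
      (fun ρ : List V => if IsStoppedAt S ρ ∧ loopErase ρ = b :: L' then pw q a ρ else 0)]
    rw [le, wsum, ← ENNReal.tsum_mul_left]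
    rw [tsum_eq_tsum_cons b]
    · refine tsum_congr fun ρ' => ?_
      rw [pw_cons]
      by_cases hle : loopErase (b :: ρ') = b :: L'
      · have key : (a ∉ b :: ρ' ∧ IsStoppedAt S (b :: ρ')) ↔
            IsStoppedAt (insert a S) (b :: ρ') := by
          constructor
          · rintro ⟨haρ, hst⟩
            exact (isStoppedAt_insert_iff haρ).2 hst
          · intro hst
            have haρ : a ∉ b :: ρ' := by
              intro hmem
              have hne : b :: ρ' ≠ [] := List.cons_ne_nil _ _
              have hlast : a = (b :: ρ').getLast hne := by
                by_contra hne'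
                exact hst.not_mem_of_mem_dropLast
                  (List.mem_dropLast_of_mem_of_ne_getLast hmem hne') (Set.mem_insert a S)
              have h3 := getLast_loopErase (l := b :: ρ') (by simp) hne
              rw [← hlast] at h3
              have h4 : a ∈ loopErase (b :: ρ') := h3 ▸ List.getLast_mem _
              rw [hle] at h4
              exact haL h4
            exact ⟨haρ, (isStoppedAt_insert_iff haρ).1 hst⟩
        by_cases h : a ∉ b :: ρ' ∧ IsStoppedAt S (b :: ρ')
        · rw [if_pos h.1, if_pos ⟨h.2, hle⟩, if_pos ⟨key.1 h, hle⟩]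
        · rw [if_neg (c := IsStoppedAt (insert a S) (b :: ρ') ∧ loopErase (b :: ρ') = b :: L')
            (fun h' => h (key.2 h'.1)), mul_zero]
          by_cases h' : a ∉ b :: ρ'
          · rw [if_pos h', if_neg (fun h'' => h ⟨h', h''.1⟩)]
          · rw [if_neg h']
      · rw [if_neg (c := IsStoppedAt (insert a S) (b :: ρ') ∧ loopErase (b :: ρ') = b :: L')
          (fun h => hle h.2), mul_zero]
        by_cases h' : a ∉ b :: ρ'
        · rw [if_pos h', if_neg (fun h => hle h.2)]
        · rw [if_neg h']
    · intro ρ hρ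
      have h1 : loopErase ρ = b :: L' := by
        by_contra hne
        apply hρ
        by_cases haρ : a ∉ ρ
        · rw [if_pos haρ, if_neg (fun h => hne h.2)]
        · rw [if_neg haρ]
      have h2 := head?_loopErase ρ
      rw [h1] at h2
      exact h2.symm
  rw [fac1, fac2, mul_assoc]

/-- **Lawler's formula for the loop-erased walk stopped at `S`** (Lawler 2018, Prop. 3.1;
Kozdron–Richards–Stroock (2013), eq. (5.4) "(Lawler)"): for a self-avoiding path `a :: L`
stopped at `S`, the mass of the stopped walks with loop erasure `a :: L` is Lawler's product
`∏_{k<K} G_{Δ_kᶜ}(y_k,y_k) q(y_k,y_{k+1})`, `Δ_k = S ∪ {y₁,…,y_{k-1}}`.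
[cite: Lawler2018, Proposition 3.1] -/
theorem le_eq_lam {S : Set V} {a : V} {L : List V} (hnd : (a :: L).Nodup)
    (hst : IsStoppedAt S (a :: L)) : le q S a L = lam q S a L := by
  induction L generalizing S a with
  | nil => rw [le_nil, lam_nil]
  | cons b L ih =>
    have haL : a ∉ b :: L := (List.nodup_cons.1 hnd).1
    have ha : a ∉ S := hst.head_not_mem (List.cons_ne_nil b L)
    rw [le_cons ha haL, lam_cons, ih (List.nodup_cons.1 hnd).2]
    exact (isStoppedAt_insert_iff haL).2 (hst.tail (List.cons_ne_nil b L))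

omit [DecidableEq V] in
/-- Lawler's product vanishes unless the path is stopped at `S` — it is supported, like `le`,
on the stopped self-avoiding paths: if some non-final vertex of `a :: L` lies in `S`, or the
final one does not, then `lam S a L = 0` — provided no earlier vertex repeats (used only through
`le_eq_lam`). We record the converse direction actually needed downstream: the `pw`-factor. For
a self-avoiding path stopped at `S`, Lawler's product is the path weight times the product of
the Green's functions at its non-final vertices:
`lam S a L = pw a L · greenProd S (a :: L).dropLast`. [cite: KozdronRichardsStroock2013, §5 (eq. (5.4))] -/
theorem lam_eq_pw_mul_greenProd {S : Set V} {a : V} {L : List V} (hnd : (a :: L).Nodup)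
    (hst : IsStoppedAt S (a :: L)) :
    lam q S a L = pw q a L * greenProd q S ((a :: L).dropLast) := by
  induction L generalizing S a with
  | nil =>
    have ha : a ∈ S := by simpa using hst.getLast_mem
    simp [ha]
  | cons b L ih =>
    have haL : a ∉ b :: L := (List.nodup_cons.1 hnd).1
    rw [lam_cons, ih (List.nodup_cons.1 hnd).2
      ((isStoppedAt_insert_iff haL).2 (hst.tail (List.cons_ne_nil b L))),
      List.dropLast_cons_cons, greenProd_cons, pw_cons]
    ring

/-- **The fibres of loop erasure partition the stopped walks**: summing the loop-erased measure
over all paths gives the total mass of the walks from `a` stopped at `S`,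
`∑_L le S a L = hit' S a` (Lawler 2018, §3 Def. 2: "`∑_η q̂(η) = q[𝒦_A]`").
[cite: Lawler2018, §3 Definition 2] -/
theorem tsum_le (S : Set V) (a : V) : ∑' L, le q S a L = hit' q S a := by
  simp only [le, wsum]
  rw [ENNReal.tsum_comm, ← wsum_isStoppedAt_cons (q := q) S a, wsum]
  refine tsum_congr fun t => ?_
  rw [tsum_eq_single (loopErase (afterLast a t))]
  · exact ite_congr_prop _ _ ⟨fun h => h.1, fun h => ⟨h, by rw [loopErase_cons]⟩⟩
  · intro L hL
    rw [if_neg]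
    rintro ⟨-, h⟩
    rw [loopErase_cons, List.cons_eq_cons] at h
    exact hL h.2.symm

/-- The loop-erased measure of a stopped self-avoiding path is the path weight times the
Green's-function product over its non-final vertices. [cite: Lawler2018, Proposition 3.1] -/
theorem le_eq_pw_mul_greenProd {S : Set V} {a : V} {L : List V} (hnd : (a :: L).Nodup)
    (hst : IsStoppedAt S (a :: L)) :
    le q S a L = pw q a L * greenProd q S ((a :: L).dropLast) := by
  rw [le_eq_lam hnd hst, lam_eq_pw_mul_greenProd hnd hst]

/-- The loop-erased measure is supported on self-avoiding paths. [folklore] -/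
theorem le_eq_zero_of_not_nodup {S : Set V} {a : V} {L : List V} (h : ¬ (a :: L).Nodup) :
    le q S a L = 0 :=
  wsum_eq_zero q fun t ht => h (ht.2 ▸ nodup_loopErase (a :: t))

/-- The loop-erased measure is supported on paths stopped at `S`. [folklore] -/
theorem le_eq_zero_of_not_isStoppedAt {S : Set V} {a : V} {L : List V}
    (h : ¬ IsStoppedAt S (a :: L)) : le q S a L = 0 :=
  wsum_eq_zero q fun _ ht => h (ht.2 ▸ ht.1.loopErase)

/-! ### Last-visit decompositions and the two-point symmetry -/

/-- **Loops through a second point**: a closed walk at `y` off `S` either misses `x`, or splits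
at its last visit to `x` into a walk `y → x` off `S` and a walk `x → y` off `S ∪ {x}`,
bijectively with multiplicative weights:
`G_{Sᶜ}(y,y) = G_{(S∪x)ᶜ}(y,y) + G_{Sᶜ}(y,x) · G_{(S∪x)ᶜ}(x,y)` (`x ≠ y`).
[cite: Lawler2018, §3 (proof of Proposition 3.1)] -/
theorem loopAt_eq_loopAt_insert_add {S : Set V} {x y : V} (hxy : x ≠ y) :
    loopAt q S y = loopAt q (insert x S) y + reach q S y x * reach q (insert x S) x y := by
  have split : ∀ t : List V,
      (if (t = [] ∨ t.getLast? = some y) ∧ Avoids S t then pw q y t else 0) =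
      (if (t = [] ∨ t.getLast? = some y) ∧ Avoids (insert x S) t then pw q y t else 0) +
      (if ((t = [] ∨ t.getLast? = some y) ∧ Avoids S t) ∧ x ∈ t then pw q y t else 0) := by
    intro t
    by_cases h : (t = [] ∨ t.getLast? = some y) ∧ Avoids S t
    · by_cases hx : x ∈ t
      · rw [if_pos h, if_neg (fun h' => (avoids_insert.1 h'.2).1 hx), if_pos ⟨h, hx⟩, zero_add]
      · rw [if_pos h, if_pos ⟨h.1, avoids_insert.2 ⟨hx, h.2⟩⟩, if_neg (fun h' => hx h'.2),
          add_zero]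
    · rw [if_neg h, if_neg (fun h' => h ⟨h'.1, (avoids_insert.1 h'.2).2⟩),
        if_neg (fun h' => h h'.1), add_zero]
  have e0 : loopAt q S y =
      ∑' t, (if (t = [] ∨ t.getLast? = some y) ∧ Avoids S t then pw q y t else 0) := by
    rw [loopAt, wsum]
    exact tsum_congr fun t => ite_congr_prop _ _ Iff.rfl
  have e1 : loopAt q (insert x S) y =
      ∑' t, (if (t = [] ∨ t.getLast? = some y) ∧ Avoids (insert x S) t then pw q y t else 0) := by
    rw [loopAt, wsum]
    exact tsum_congr fun t => ite_congr_prop _ _ Iff.rfl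
  rw [e0, e1]
  simp_rw [split]
  rw [ENNReal.tsum_add]
  congr 1
  -- the loops through `x`, split at the last visit to `x`
  rw [tsum_eq_tsum_splitLast x]
  have step : ∀ p : {c : List V // c = [] ∨ c.getLast? = some x} × {ρ : List V // x ∉ ρ},
      (if (((p.1.1 ++ p.2.1) = [] ∨ (p.1.1 ++ p.2.1).getLast? = some y) ∧
          Avoids S (p.1.1 ++ p.2.1)) ∧ x ∈ p.1.1 ++ p.2.1 then pw q y (p.1.1 ++ p.2.1) else 0) =
      (if p.1.1.getLast? = some x ∧ Avoids S p.1.1 then pw q y p.1.1 else 0) *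
        (if p.2.1.getLast? = some y ∧ Avoids (insert x S) p.2.1 then pw q x p.2.1 else 0) := by
    rintro ⟨⟨c, hc⟩, ⟨ρ, hρ⟩⟩
    simp only
    by_cases h1 : c.getLast? = some x ∧ Avoids S c
    · by_cases h2 : ρ.getLast? = some y ∧ Avoids (insert x S) ρ
      · have hρne : ρ ≠ [] := by rintro rfl; simp at h2
        rw [if_pos h1, if_pos h2, pw_append_of_getLast? q h1.1, if_pos]
        refine ⟨⟨Or.inr ?_, avoids_append.2 ⟨h1.2, (avoids_insert.1 h2.2).2⟩⟩,
          List.mem_append_left ρ (List.mem_of_getLast? h1.1)⟩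
        rw [List.getLast?_append_of_ne_nil _ hρne, h2.1]
      · rw [if_neg h2, mul_zero, if_neg]
        rintro ⟨⟨hl, hav⟩, -⟩
        refine h2 ⟨?_, avoids_insert.2 ⟨hρ, (avoids_append.1 hav).2⟩⟩
        have hρne : ρ ≠ [] := by
          rintro rfl
          simp only [List.append_nil] at hl
          rcases hl with rfl | hl
          · simp at h1
          · rw [h1.1] at hl
            exact hxy (Option.some_inj.1 hl)
        rcases hl with hl | hl
        · simp [hρne] at hl
        · rwa [List.getLast?_append_of_ne_nil _ hρne] at hl
    · rw [if_neg h1, zero_mul, if_neg]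
      rintro ⟨⟨-, hav⟩, hx⟩
      refine h1 ⟨?_, (avoids_append.1 hav).1⟩
      rcases hc with rfl | hc
      · simp only [List.nil_append] at hx
        exact absurd hx hρ
      · exact hc
  trans ∑' p : {c : List V // c = [] ∨ c.getLast? = some x} × {ρ : List V // x ∉ ρ},
      (if p.1.1.getLast? = some x ∧ Avoids S p.1.1 then pw q y p.1.1 else 0) *
        (if p.2.1.getLast? = some y ∧ Avoids (insert x S) p.2.1 then pw q x p.2.1 else 0)
  · exact tsum_congr fun p => by convert step p using 3
  rw [ENNReal.tsum_prod']
  simp_rw [ENNReal.tsum_mul_left]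
  rw [ENNReal.tsum_mul_right]
  congr 1
  · rw [tsum_subtype_eq_tsum_ite (fun c : List V => c = [] ∨ c.getLast? = some x)
      (fun c : List V => if c.getLast? = some x ∧ Avoids S c then pw q y c else 0), reach, wsum]
    refine tsum_congr fun c => ?_
    by_cases hc : c = [] ∨ c.getLast? = some x
    · rw [if_pos hc]
      exact ite_congr_prop _ _ Iff.rfl
    · rw [if_neg hc, if_neg (fun h => hc (Or.inr h.1))]
  · rw [tsum_subtype_eq_tsum_ite (fun ρ : List V => x ∉ ρ)
      (fun ρ : List V => if ρ.getLast? = some y ∧ Avoids (insert x S) ρ then pw q x ρ else 0),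
      reach, wsum]
    refine tsum_congr fun ρ => ?_
    by_cases hρ : x ∉ ρ
    · rw [if_pos hρ]
      exact ite_congr_prop _ _ Iff.rfl
    · rw [if_neg hρ, if_neg (fun h => hρ (avoids_insert.1 h.2).1)]

/-- **Walks to a second point, split at the last visit to the start**: a walk `y → x` off `S`
(`x ≠ y`) is a closed walk at `y` off `S` followed by a walk `y → x` off `S ∪ {y}`,
bijectively: `G_{Sᶜ}(y,x) = G_{Sᶜ}(y,y) · G_{(S∪y)ᶜ}(y,x)`.
[cite: Lawler2018, §3 (proof of Proposition 3.1)] -/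
theorem reach_eq_loopAt_mul_reach {S : Set V} {x y : V} (hxy : x ≠ y) :
    reach q S y x = loopAt q S y * reach q (insert y S) y x := by
  have e0 : reach q S y x = ∑' t, (if t.getLast? = some x ∧ Avoids S t then pw q y t else 0) := by
    rw [reach, wsum]
    exact tsum_congr fun t => ite_congr_prop _ _ Iff.rfl
  rw [e0, tsum_eq_tsum_splitLast y]
  have step : ∀ p : {c : List V // c = [] ∨ c.getLast? = some y} × {ρ : List V // y ∉ ρ},
      (if (p.1.1 ++ p.2.1).getLast? = some x ∧ Avoids S (p.1.1 ++ p.2.1)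
        then pw q y (p.1.1 ++ p.2.1) else 0) =
      (if (p.1.1 = [] ∨ p.1.1.getLast? = some y) ∧ Avoids S p.1.1 then pw q y p.1.1 else 0) *
        (if p.2.1.getLast? = some x ∧ Avoids (insert y S) p.2.1 then pw q y p.2.1 else 0) := by
    rintro ⟨⟨c, hc⟩, ⟨ρ, hρ⟩⟩
    simp only
    by_cases h2 : ρ.getLast? = some x ∧ Avoids (insert y S) ρ
    · have hρne : ρ ≠ [] := by rintro rfl; simp at h2
      rw [if_pos h2]
      by_cases h1 : Avoids S c
      · rw [if_pos, if_pos ⟨hc, h1⟩, pw_append_of_loop q hc]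
        rw [List.getLast?_append_of_ne_nil _ hρne]
        exact ⟨h2.1, avoids_append.2 ⟨h1, (avoids_insert.1 h2.2).2⟩⟩
      · rw [if_neg (fun h => h1 (avoids_append.1 h.2).1), if_neg (fun h => h1 h.2), zero_mul]
    · rw [if_neg h2, mul_zero, if_neg]
      rintro ⟨hl, hav⟩
      have hρne : ρ ≠ [] := by
        rintro rfl
        simp only [List.append_nil] at hl
        rcases hc with rfl | hc
        · simp at hl
        · rw [hc] at hl
          exact hxy (Option.some_inj.1 hl).symm
      refine h2 ⟨?_, avoids_insert.2 ⟨hρ, (avoids_append.1 hav).2⟩⟩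
      rwa [List.getLast?_append_of_ne_nil _ hρne] at hl
  trans ∑' p : {c : List V // c = [] ∨ c.getLast? = some y} × {ρ : List V // y ∉ ρ},
      (if (p.1.1 = [] ∨ p.1.1.getLast? = some y) ∧ Avoids S p.1.1 then pw q y p.1.1 else 0) *
        (if p.2.1.getLast? = some x ∧ Avoids (insert y S) p.2.1 then pw q y p.2.1 else 0)
  · exact tsum_congr fun p => by convert step p using 3
  rw [ENNReal.tsum_prod']
  simp_rw [ENNReal.tsum_mul_left]
  rw [ENNReal.tsum_mul_right]
  congr 1
  · rw [tsum_subtype_eq_tsum_ite (fun c : List V => c = [] ∨ c.getLast? = some y)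
      (fun c : List V => if (c = [] ∨ c.getLast? = some y) ∧ Avoids S c then pw q y c else 0),
      loopAt, wsum]
    refine tsum_congr fun c => ?_
    by_cases hc : c = [] ∨ c.getLast? = some y
    · rw [if_pos hc]
      exact ite_congr_prop _ _ Iff.rfl
    · rw [if_neg hc, if_neg (fun h => hc h.1)]
  · rw [tsum_subtype_eq_tsum_ite (fun ρ : List V => y ∉ ρ)
      (fun ρ : List V => if ρ.getLast? = some x ∧ Avoids (insert y S) ρ then pw q y ρ else 0),
      reach, wsum]
    refine tsum_congr fun ρ => ?_
    by_cases hρ : y ∉ ρ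
    · rw [if_pos hρ]
      exact ite_congr_prop _ _ Iff.rfl
    · rw [if_neg hρ, if_neg (fun h => hρ (avoids_insert.1 h.2).1)]

omit [DecidableEq V] in
/-- `reach` is antitone in the avoided set. [folklore] -/
theorem reach_insert_le (S : Set V) (z x y : V) : reach q (insert z S) x y ≤ reach q S x y :=
  wsum_mono q fun _ h => ⟨h.1, (avoids_insert.1 h.2).2⟩

/-- **The two-point symmetry of the Green's-function products** (the `2 × 2` case of the order
independence, Kozdron–Richards–Stroock (2013), Thm. 2.1): for `x ≠ y` off `S`, with all the
Green's functions involved finite,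
`G_{Sᶜ}(x,x) · G_{(S∪x)ᶜ}(y,y) = G_{Sᶜ}(y,y) · G_{(S∪y)ᶜ}(x,x)`
(both are `G(x,x)G(y,y) - G(x,y)G(y,x)` in `Sᶜ`). [cite: KozdronRichardsStroock2013, Theorem 2.1] -/
theorem loopAt_mul_loopAt_insert_comm {S : Set V} {x y : V} (hxy : x ≠ y)
    (hx : loopAt q S x ≠ ⊤) (hy : loopAt q S y ≠ ⊤) (hxy' : reach q S x y ≠ ⊤)
    (hyx' : reach q S y x ≠ ⊤) :
    loopAt q S x * loopAt q (insert x S) y = loopAt q S y * loopAt q (insert y S) x := by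
  have hExy : reach q (insert x S) x y ≠ ⊤ := ne_top_of_le_ne_top hxy' (reach_insert_le S x x y)
  have hEyx : reach q (insert y S) y x ≠ ⊤ := ne_top_of_le_ne_top hyx' (reach_insert_le S y y x)
  -- (1): G(x) G(y) = G(x) G_{S∪x}(y) + G(x) G(y) E_yx E_xy
  have h1 : loopAt q S x * loopAt q S y =
      loopAt q S x * loopAt q (insert x S) y +
        loopAt q S x * loopAt q S y * reach q (insert y S) y x * reach q (insert x S) x y := by
    conv_lhs => rw [loopAt_eq_loopAt_insert_add (q := q) (S := S) hxy,
      reach_eq_loopAt_mul_reach (q := q) (S := S) hxy]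
    ring
  -- (2): G(y) G(x) = G(y) G_{S∪y}(x) + G(y) G(x) E_xy E_yx
  have h2 : loopAt q S y * loopAt q S x =
      loopAt q S y * loopAt q (insert y S) x +
        loopAt q S x * loopAt q S y * reach q (insert y S) y x * reach q (insert x S) x y := by
    conv_lhs => rw [loopAt_eq_loopAt_insert_add (q := q) (S := S) (Ne.symm hxy),
      reach_eq_loopAt_mul_reach (q := q) (S := S) (Ne.symm hxy)]
    ring
  have hfin : loopAt q S x * loopAt q S y * reach q (insert y S) y x * reach q (insert x S) x y ≠
      ⊤ :=
    ENNReal.mul_ne_top (ENNReal.mul_ne_top (ENNReal.mul_ne_top hx hy) hEyx) hExy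
  have h := h1.symm.trans ((mul_comm _ _).trans h2)
  exact (ENNReal.add_left_inj hfin).1 h

/-! ### Order independence of the Green's-function product -/

/-- A positive-weight walk into `S` can be stopped earlier, at `S ∪ {x}`. [folklore] -/
theorem exists_stopped_insert {S : Set V} (x : V) :
    ∀ (t : List V) (z : V), IsStoppedAt S t → pw q z t ≠ 0 →
      ∃ t', IsStoppedAt (insert x S) t' ∧ pw q z t' ≠ 0 := by
  intro t
  induction t with
  | nil => exact fun z h _ => absurd h (not_isStoppedAt_nil S)
  | cons y t ih =>
    intro z hst hpw
    rw [pw_cons_ne_zero_iff] at hpw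
    by_cases hy : y ∈ insert x S
    · exact ⟨[y], isStoppedAt_singleton hy, by simpa using hpw.1⟩
    · have hyS : y ∉ S := fun h => hy (Set.mem_insert_of_mem x h)
      rw [isStoppedAt_cons_iff] at hst
      rcases hst with ⟨hyS', -⟩ | ⟨-, hst⟩
      · exact absurd hyS' hyS
      · obtain ⟨t', ht', hpw'⟩ := ih y hst hpw.2
        exact ⟨y :: t', ht'.cons hy, by rw [pw_cons]; exact mul_ne_zero hpw.1 hpw'⟩

/-- **Accessibility**: from every vertex off `S` some walk of positive weight leads into `S`
(Kozdron–Richards–Stroock (2013), §3: "`Δ` is accessible from `x ∉ Δ`").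
[cite: KozdronRichardsStroock2013, §3] -/
def Accessible (q : V → V → ℝ≥0∞) (S : Set V) : Prop :=
  ∀ z, z ∉ S → ∃ t, IsStoppedAt S t ∧ pw q z t ≠ 0

/-- Accessibility is inherited by larger target sets. [folklore] -/
theorem Accessible.insert {S : Set V} (h : Accessible q S) (x : V) :
    Accessible q (insert x S) := fun z hz => by
  obtain ⟨t, ht, hpw⟩ := h z (fun h' => hz (Set.mem_insert_of_mem x h'))
  exact exists_stopped_insert x t z ht hpw

/-- **The product of Green's functions along an ordering does not depend on the ordering**
(Kozdron–Richards–Stroock (2013), Thm. 2.1: "the interest in (2.2) is … that it shows that the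
product on the left is independent of the permutation `σ`"), for a substochastic weight with
`S` accessible: if `l` and `l'` enumerate the same vertices off `S` without repetition, then
`greenProd S l = greenProd S l'`. Proof by adjacent transpositions (`List.Perm` induction) and
the two-point symmetry `loopAt_mul_loopAt_insert_comm`. [cite: KozdronRichardsStroock2013, Theorem 2.1] -/
theorem greenProd_perm (hsub : ∀ z, ∑' y, q z y ≤ 1) {l l' : List V} (h : l.Perm l') :
    ∀ {S : Set V}, Accessible q S → l.Nodup → Avoids S l → greenProd q S l = greenProd q S l' := by
  induction h with
  | nil => intros; rfl
  | cons x _ ih =>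
    intro S hacc hnd hav
    rw [greenProd_cons, greenProd_cons, ih (hacc.insert x) (List.nodup_cons.1 hnd).2
      (avoids_insert.2 ⟨(List.nodup_cons.1 hnd).1, (avoids_cons.1 hav).2⟩)]
  | swap x y l =>
    intro S hacc hnd hav
    -- `l` here is `y :: x :: l ~ x :: y :: l`
    simp only [greenProd_cons]
    rw [Set.insert_comm]
    have hxy : x ≠ y := by
      intro h
      subst h
      simp at hnd
    obtain ⟨hyS, hxS, -⟩ : y ∉ S ∧ x ∉ S ∧ True := by
      rw [avoids_cons, avoids_cons] at hav
      exact ⟨hav.1, hav.2.1, trivial⟩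
    obtain ⟨tx, htx, hpx⟩ := hacc x hxS
    obtain ⟨ty, hty, hpy⟩ := hacc y hyS
    have key := loopAt_mul_loopAt_insert_comm (q := q) (S := S) (Ne.symm hxy)
      (loopAt_ne_top hsub hty hpy) (loopAt_ne_top hsub htx hpx)
      (reach_ne_top hsub htx hpx) (reach_ne_top hsub hty hpy)
    -- key : G y * G_{S∪y} x = G x * G_{S∪x} y
    rw [← mul_assoc, ← mul_assoc, key]
  | trans h₁ _ ih₁ ih₂ =>
    intro S hacc hnd hav
    rw [ih₁ hacc hnd hav, ih₂ hacc (h₁.nodup_iff.1 hnd) (fun v hv => hav v (h₁.mem_iff.2 hv))]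

/-! ### Support on the paths of a graph -/

omit [DecidableEq V] in
/-- Walks of weight zero do not contribute to a mass. [folklore] -/
theorem wsum_eq_zero_of_pw {x : V} {P : List V → Prop} (h : ∀ t, P t → pw q x t = 0) :
    wsum q x P = 0 := by
  unfold wsum
  refine ENNReal.tsum_eq_zero.2 fun t => ?_
  by_cases hP : P t
  · rw [if_pos hP, h t hP]
  · rw [if_neg hP]

omit [DecidableEq V] in
/-- For a weight supported on the edges of a graph `H`, a walk of nonzero weight is an
`H`-path. [folklore] -/
theorem isChain_of_pw_ne_zero {H : SimpleGraph V} (hq : ∀ x y, q x y ≠ 0 → H.Adj x y) :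
    ∀ (t : List V) (x : V), pw q x t ≠ 0 → List.IsChain H.Adj (x :: t)
  | [], _, _ => List.isChain_singleton _
  | y :: t, x, h => by
    rw [pw_cons_ne_zero_iff] at h
    exact List.isChain_cons_cons.2 ⟨hq x y h.1, isChain_of_pw_ne_zero hq t y h.2⟩

/-- For a weight supported on the edges of `H`, the loop-erased measure is supported on
`H`-paths (the loop erasure of an `H`-path is an `H`-path). [folklore] -/
theorem le_eq_zero_of_not_isChain {H : SimpleGraph V} (hq : ∀ x y, q x y ≠ 0 → H.Adj x y)
    {S : Set V} {v : V} {L : List V} (h : ¬ List.IsChain H.Adj (v :: L)) : le q S v L = 0 :=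
  wsum_eq_zero_of_pw fun t ht => by
    by_contra hne
    exact h (ht.2 ▸ isChain_loopErase (isChain_of_pw_ne_zero hq t v hne))

end StoppedWalk

end Literature.Probability.LatticeModels
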